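import Summits.AtomisticToContinuum.Crystallization.Theses.IsometryAtoms
import Summits.AtomisticToContinuum.Crystallization.Theorems.MinimisingLawsCohesive.Negative.OnePointMixtures
import Literature.Geometry.DiscreteGeometry.MultiregularPointSystems
import Literature.Geometry.DiscreteGeometry.CrystallographicGroups
import Summits.AtomisticToContinuum.Crystallization.Theorems.PalmUnimodularRigidityMinimiserShellsEnergyFloor
import Summits.AtomisticToContinuum.Crystallization.Theorems.IsometryAtomsMinimisingLawsCohesive

/-!
# Line `purity_stacking` — crux `IsometryAtoms.MinimisingLawsCohesive` (stmt-AtomisticToContinuum-15777)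

Crux-strategist `planner-cstrat-stmt-AtomisticToContinuum-15777-b1-0` (2026-08-17), route
`route-AtomisticToContinuum-IsometryAtoms` (sub-problem `Crystallization`). Second registered line
of the crux (the first is `Lines/birth.lean`: exposure premium = positive surface tension of
Lennard-Jones matter, open). Published as `Cruxes/MinimisingLawsCohesive/Lines/purity_stacking.lean`.

THE CRUX (COHESION, rank 3). For every hard core `δ > 0` and every probability law `P` on rooted
configurations `μ : Measure ℝ³` that is a.s. `IsRootedHardCore δ`, `IsPointStationaryLaw` (Mecke /
mass transport) and MINIMISING (`∫ rootEnergy V_LJ dP ≤ e* := ⨅_Q e(Q)` over periodic `Q`):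
`P`-a.s. the configuration is relatively dense, `∃ R₀, ∀ z, ∃ y, μ {y} ≠ 0 ∧ dist z y ≤ R₀`.

## The line — COHESION RIDES ON PURITY: pure atomicity + orbit finiteness + Bieberbach + stacking

The route's `closes` consumes the two cruxes `MinimisingLawsHaveAtoms` (X₁, PURITY, rank 2) and
`MinimisingLawsCohesive` (X₂, this crux) side by side. This line shows that X₂ FOLLOWS from X₁ and
four lemmas that are provable now, none of which touches surface tension — the stuck content of
line `birth` (`stub_exposurePremium`, the open `E(N) − N e* ≳ N^{2/3}` physics):

* `stub_energyFloor` — PALM STABILITY (L, true on paper, NECESSARY for the crux: it is the first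
  conjunct of the landed `Negative.OnePointMixtures.minimisingLawsCohesive_iff_stable_and_exact`;
  `crux_implies_energyFloor` below re-derives it from the crux): `e* ≤ E_P[rootEnergy]` for EVERY
  point-stationary a.s.-hard-core probability law. Proof route = line `birth`'s `stub_premiumTransfer`
  at `κ = 0`: randomly shifted cubic grid (hyperfinite exhaustion valid for every point-stationary law,
  no intensity needed) + cell-averaged Mecke + `ChargedEnergyGapNegative.card_mul_eStar_le` on each
  window + `r⁻⁶` cut bound. It makes "minimising" a FACE of the convex set of admissible laws:
  conditioning a minimising law on an invariant event of positive mass gives a minimising law.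
* `stub_pureExhaustion` — PURE ATOMICITY (M/L, soft measure theory GIVEN X₁ and the floor): every
  minimising law is carried by its charged rooted-isometry classes: `P`-a.e. `μ` lies in `Cls Y` for
  some `Y` with `P (Cls Y) > 0`. Proof: the classes `Cls Y` are pairwise equal or disjoint, so at
  most countably many are charged; their union `C` is re-rooting invariant and measurable (each
  charged `Y` is `δ`-separated, and `Cls Y` is then an `F_σ` of the locally-finite configurations, cf.
  the bridge line's `stub_measurableSet_isometryClass`); if `P(Cᶜ) > 0`, condition on `Cᶜ`
  (invariant ⇒ point-stationary; floor ⇒ still minimising), apply X₁ to get a charged class inside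
  `Cᶜ` — contradiction.
* `stub_finiteOrbitsOfCharged` — ORBIT FINITENESS OF ATOMS (L; the NEW load-bearing Palm lemma, no
  energy, no Delone hypothesis): if a point-stationary a.s.-hard-core law charges `Cls Y`, then
  `Sym(Y)` has finitely many orbits on `Y`. Proof: `Cls Y = ⊔_{a ∈ Y/Γ} K_a` by root class; Mecke
  with `g(μ, y) = 1_{K_a}(μ) 1_{K_b}(θ_y μ) 1{‖y‖ ≤ r}` gives `m(a) n_ab(r) = m(b) n_ba(r)` for the
  class masses; since `n_ab(r) = N_ab(r)/|Stab_b|` and `n_ba(r) = N_ab(r)/|Stab_a|` with the SAME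
  numerator `N_ab(r) = #{γ ∈ Γ : ‖γ q_b − q_a‖ ≤ r} > 0`, the MASS FORMULA `m(b)·|Stab_b| = const > 0`
  holds for every class; stabiliser orders are bounded in a discrete Euclidean group (finite
  subgroups inject into `Γ/A`, `A ≅ ℤᵐ` torsion-free of finite index —
  `Crystallographic.discreteEuclideanGroupStructure`), so `m(b)` is bounded below and `Y/Γ` is finite
  (`Σ m ≤ 1`). (Coplanar / collinear / finite `Y`: use the effective symmetry group of the affine
  span; same computation.) For Delone `Y` this is the pair `stub_cubicGrowthOfChargedClass` +
  `stub_finiteOrbitsOfCubicGrowth` of the bridge's line `AtomicLawChargesCrystal/Lines/birth.lean`;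
  here it is needed — and true — WITHOUT relative density (a single triangular layer, a helical rod,
  a finite cluster all qualify; the half-crystal `ℤ² × δℕ` and every aperiodic layer stacking do NOT
  carry a point-stationary atom: all levels would get equal mass).
* `stub_slabOrDense` — BIEBERBACH DICHOTOMY (L; deterministic discrete geometry, no law, no energy):
  a rooted hard-core copy `μ ∈ Cls Y` of a set with finitely many symmetry orbits is either
  relatively dense or lies in a SLAB `{|⟨·, n⟩| ≤ D}`. Proof: finite or coplanar `Y` ⇒ slab; else
  `Sym(Y)` acts discontinuously (an isometry is fixed by 4 affinely independent points of a
  separated set), the structure theorem (`discreteEuclideanGroupStructure 3`, named fact: Thurston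
  Thm 4.2.2(a) + Prop 4.2.5) gives an invariant flat `V` of dimension `m` on which a finite-index
  `A ≅ ℤᵐ` acts by translations; finitely many orbits ⇒ `Y ⊆ N_D(V)`; `m ≤ 2` ⇒ slab, `m = 3` ⇒ the
  translation vectors of `A` form a full lattice `L` (discrete, `≅ ℤ³`) and `Y ⊇ y + L` is relatively
  dense. (Shared debt with the bridge line's `stub_idealCrystalOfFiniteOrbits`: Bieberbach for
  `E(3)` is not in Mathlib.)
* `stub_noSlabs` — STACKING KILLS FILMS, RODS AND CLUSTERS (L; the cheap half of cohesion, recorded by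
  the vetting refuter as a paper argument, here a stub): GIVEN the floor, a minimising law charges no
  slab configuration. Proof: `SLAB` is a re-rooting-invariant measurable event; if `P(SLAB) > 0`,
  condition on it (floor ⇒ the conditioned law `P_S` is still minimising); for `μ ∈ SLAB` with
  half-width `D(μ)` (minimal integer half-width, a translation-invariant measurable function) stack
  the translates `μ + k t n`, `k ∈ ℤ`, `t = 2D + 1`, along an admissible normal `n` chosen
  EQUIVARIANTLY (the admissible-normal set `N(μ) ⊂ S²` is `{±n₀}`, a great circle or `S²`; use its
  lexicographic minimum, or randomise `n` by the nearest-point projection of a uniform direction onto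
  `N(μ)` — either choice depends only on the translation class of `supp μ`, which is all the Mecke
  identity of the stacked law needs: `θ_{y + ktn} Stack(μ) = Stack(θ_y μ)`); all cross pairs differ by
  `≥ t − 2D ≥ 1` along `n`, so the stacked configuration is `min(δ,1)`-hard-core and EVERY cross term is
  `V_LJ(r) < 0` (`r ≥ 1 > 2^{-1/6}`), absolutely summable (`r⁻⁶` over a separated set), and the term
  `k = 1, y = 0` is `V_LJ(t) < 0`: the stacked law is an admissible probability law with
  `E[rootEnergy] < E_{P_S}[rootEnergy] ≤ e*`, contradicting the floor.

COMPOSITION (`MinimisingLawsCohesive_of`, sorry-free, concludes the route decl BY NAME; its first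
hypothesis is the route item `MinimisingLawsHaveAtoms` by name, admissible as a registered
obligation): a.e. `μ` lies in a charged class `Cls Y` (exhaustion fed with X₁ and the floor); `Y` has
finitely many orbits (orbit finiteness); so `μ` is relatively dense or a slab (dichotomy, using that
a.e. `μ` is hard-core); slabs are a.s. excluded (stacking fed with the floor). No energy estimate, no
surface, no finite-`n` statement appears anywhere: the energy enters through the floor and the sign
of `V_LJ` beyond distance `1` only.

WHY IT DODGES THE STUCK GOAL OF `birth`: `birth` must price the walls of large cavities in ARBITRARY
minimising laws (positive surface tension, `E(N) − N e* ≳ #exposed`, open even in its weakest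
large-cavity form because wall sites may sit below `e*` — one-centre frustration). Here the only
configurations whose cohesion is ever examined are ATOMS of point-stationary laws, which are rigid
(finitely many orbits under a discrete Euclidean group): a non-relatively-dense atom is automatically
lower-dimensional, and lower-dimensional matter is killed by stacking whole translates of ITSELF into
its own vacuum — a competitor with NO surface cost at all. The price: the line is conditional on the
sibling crux X₁ (PURITY), which `closes` consumes anyway; if X₁ is refuted the route is closed
(KILL CRITERIA of the route header) and this line with it.

DISPROOF / NEGATIVES USED: no `Disproof.lean` exists for this crux. Landed Negative lemmas
`Theorems/MinimisingLawsCohesive/Negative/OnePointMixtures.lean` (threshold `e*` sharp; crux ⇒ Palm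
stability; crux ↔ stability ∧ exact cohesion) and `RootedComb.lean` (point-stationarity load-bearing)
are honoured: `stub_energyFloor` IS the stability conjunct (used by `stub_pureExhaustion` and
`stub_noSlabs` to keep conditioned laws minimising — "any proof must use the exact value `e*`"), and
point-stationarity is used three times (exhaustion: invariant conditioning; orbit finiteness: Mecke
balance; stacking: Mecke for the stacked law). `AtomicLawChargesCrystal/Negative/FalseWithoutRelDense`
(the one-point law `δ_{δ_0}` is an admissible atom) is consistent: `δ_{δ_0}` is a slab atom with
energy `0 > e*`, excluded by the floor inside `stub_noSlabs`. Negatives index (21 entries, 4 on this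
sub-problem: 15929, 17253, 4146, 3506): none is an instance of a stub (no pricing, no shells, no
windows here).
-/

noncomputable section

namespace Summit.AtomisticToContinuum.Crystallization.Cruxes.MinimisingLawsCohesive.PurityStacking

open MeasureTheory
open Literature.MathematicalPhysics.StatisticalMechanics Literature.Probability.Process
open Summit.AtomisticToContinuum.Crystallization.Theses.IsometryAtoms
  (MinimisingLawsCohesive MinimisingLawsHaveAtoms)

/-! ## §1 Vocabulary and the statements (named Props; the registered stubs of §2 restate them verbatim)

LEAD RESHAPE (prover-line-stmt-AtomisticToContinuum-15777-0, cycle 1). The strategist's five stubs are re-cut: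
(S1) `EnergyFloor` is NOT a stub any more — it is the tree theorem
`PalmUnimodularRigidityMinimiserShells.EnergyFloor.stub_energyFloor : UnimodularEnergyLowerBound` (item 9229),
definitionally this statement (`energyFloor` below, by `exact`). The two shared technical debts become stubs of their
own, consumed BY STATEMENT by the stubs that need them: (A) `MeasurableClass` — Giry measurability of a single-root
congruence class of a separated set (needed by B and C); (G) `SymDiscontinuous` — the symmetry group of a separated
non-coplanar set moves a ball onto itself only finitely often (needed by C and D); (F) `GroupStructure` — structure of
discontinuous groups of isometries of `ℝ³`: finite subgroups have bounded order, and either three independent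
translations or an invariant proper affine subspace (elementary Bieberbach in dimension three; needed by C and D).
(C) is restricted to NON-COPLANAR charged sets (the composition only calls it on configurations that are not slabs),
which removes the collinear case with its infinite stabilisers. -/

/-- The **rooted isometry class** of a point set `Y ⊆ ℝ³`: the counting measures of the moved
copies `A(Y − q)`, `A` a linear isometry, `q ∈ Y` the point placed at the root — verbatim the event
charged by the sibling crux `MinimisingLawsHaveAtoms`. -/
def Cls (Y : Set (EuclideanSpace ℝ (Fin 3))) : Set (Measure (EuclideanSpace ℝ (Fin 3))) :=
  {μ | ∃ A : EuclideanSpace ℝ (Fin 3) →ₗᵢ[ℝ] EuclideanSpace ℝ (Fin 3), ∃ q ∈ Y,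
    μ = (Measure.count : Measure (EuclideanSpace ℝ (Fin 3))).restrict ((fun s => A (s - q)) '' Y)}

/-- `μ` is **relatively dense** (verbatim the conclusion of the crux). -/
def RelDense (μ : Measure (EuclideanSpace ℝ (Fin 3))) : Prop :=
  ∃ R₀ : ℝ, ∀ z : EuclideanSpace ℝ (Fin 3), ∃ y : EuclideanSpace ℝ (Fin 3), μ {y} ≠ 0 ∧ dist z y ≤ R₀

/-- `μ` is a **slab configuration**: in some orthonormal frame `A` the first coordinate is bounded on
the points of `μ` (films, layers, rods, finite clusters: everything with a free direction). -/
def Slab (μ : Measure (EuclideanSpace ℝ (Fin 3))) : Prop :=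
  ∃ A : EuclideanSpace ℝ (Fin 3) →ₗᵢ[ℝ] EuclideanSpace ℝ (Fin 3), ∃ D : ℝ,
    ∀ y : EuclideanSpace ℝ (Fin 3), μ {y} ≠ 0 → |A y 0| ≤ D

/-- **(S1) Energy floor / Palm stability** (`e* ≤ E_P[rootEnergy]` for every point-stationary
a.s.-`δ`-hard-core probability law). PROVED in the tree (`energyFloor` below); kept as a named Prop
because (B) and (E) take it as a hypothesis. -/
def EnergyFloor : Prop :=
  ∀ δ : ℝ, 0 < δ → ∀ P : Measure (Measure (EuclideanSpace ℝ (Fin 3))), IsProbabilityMeasure P →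
    (∀ᵐ μ ∂P, IsRootedHardCore δ μ) → IsPointStationaryLaw P →
    (⨅ Q : PeriodicConfiguration 3, Q.energyPerParticle lennardJones) ≤
      ∫ μ, rootEnergy lennardJones μ ∂P

/-- **(A) Measurable classes**: for a `δ`-separated `Y ⊆ ℝ³` and any `q`, the single-root congruence
class `{count|A(Y − q) : A a linear isometry}` is measurable in the Giry σ-algebra. (Finite nets of
`O(3)` + separation: membership is a countable Boolean combination of evaluations `μ(B) ∈ I` on balls.) -/
def MeasurableClass : Prop :=
  ∀ δ : ℝ, 0 < δ → ∀ Y : Set (EuclideanSpace ℝ (Fin 3)),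
    (∀ x ∈ Y, ∀ y ∈ Y, x ≠ y → δ ≤ dist x y) → ∀ q : EuclideanSpace ℝ (Fin 3),
    MeasurableSet {μ : Measure (EuclideanSpace ℝ (Fin 3)) |
      ∃ A : EuclideanSpace ℝ (Fin 3) →ₗᵢ[ℝ] EuclideanSpace ℝ (Fin 3),
        μ = (Measure.count : Measure (EuclideanSpace ℝ (Fin 3))).restrict ((fun s => A (s - q)) '' Y)}

/-- **(G) Discontinuity of the symmetry group**: for a `δ`-separated NON-COPLANAR `Y ⊆ ℝ³` and every
radius `R`, only finitely many Euclidean isometries `g` with `g(Y) = Y` move some point of the closed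
ball `B̄(0, R)` into `B̄(0, R)` (an isometry is determined by the images of four affinely independent
points of `Y`, which land in the finite set `Y ∩ B̄(0, R')`). -/
def SymDiscontinuous : Prop :=
  ∀ δ : ℝ, 0 < δ → ∀ Y : Set (EuclideanSpace ℝ (Fin 3)),
    (∀ x ∈ Y, ∀ y ∈ Y, x ≠ y → δ ≤ dist x y) →
    (¬ ∃ n : EuclideanSpace ℝ (Fin 3), n ≠ 0 ∧ ∃ c : ℝ, ∀ y ∈ Y, inner ℝ y n = c) →
    ∀ R : ℝ, {g : EuclideanSpace ℝ (Fin 3) ≃ᵃⁱ[ℝ] EuclideanSpace ℝ (Fin 3) |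
      g '' Y = Y ∧ ∃ x : EuclideanSpace ℝ (Fin 3), ‖x‖ ≤ R ∧ ‖g x‖ ≤ R}.Finite

/-- **(F) Structure of discontinuous groups of isometries of `ℝ³`** (elementary Bieberbach in
dimension three): for `Γ ≤ Isom(ℝ³)` acting discontinuously, (i) the finite subgroups of `Γ` have
bounded order, and (ii) either `Γ` contains three linearly independent translations, or `Γ` leaves
invariant a nonempty affine subspace of dimension `≤ 2` (a point, a line or a plane). Proof by the rank
of the translation lattice: rank 3 ⇒ (ii-a) and finite point group; rank 2 ⇒ invariant plane; rank 1 ⇒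
invariant line (a subgroup of `Isom(ℝ²)` without translations fixes a point); rank 0 ⇒ `Γ` finite (fixed
point) or, by the `SO(3)` commutator contraction, all linear parts preserve one axis ⇒ invariant line. -/
def GroupStructure : Prop :=
  ∀ Γ : Subgroup (EuclideanSpace ℝ (Fin 3) ≃ᵢ EuclideanSpace ℝ (Fin 3)),
    Literature.Geometry.DiscreteGeometry.Crystallographic.IsDiscontinuous Γ →
    (∃ N : ℕ, ∀ H : Subgroup (EuclideanSpace ℝ (Fin 3) ≃ᵢ EuclideanSpace ℝ (Fin 3)),
        H ≤ Γ → Finite H → Nat.card H ≤ N) ∧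
    ((∃ v : Fin 3 → EuclideanSpace ℝ (Fin 3),
        LinearIndependent ℝ v ∧ ∀ i, IsometryEquiv.addRight (v i) ∈ Γ) ∨
     (∃ V : AffineSubspace ℝ (EuclideanSpace ℝ (Fin 3)),
        (V : Set (EuclideanSpace ℝ (Fin 3))).Nonempty ∧ Module.finrank ℝ V.direction ≤ 2 ∧
        ∀ g ∈ Γ, g '' (V : Set (EuclideanSpace ℝ (Fin 3))) = V))

/-- **(B) Pure exhaustion**: GIVEN purity (X₁), the floor (S1) and measurable classes (A), every
minimising law is carried by its charged rooted-isometry classes. -/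
def PureExhaustion : Prop :=
  MinimisingLawsHaveAtoms → EnergyFloor → MeasurableClass →
    ∀ δ : ℝ, 0 < δ → ∀ P : Measure (Measure (EuclideanSpace ℝ (Fin 3))), IsProbabilityMeasure P →
      (∀ᵐ μ ∂P, IsRootedHardCore δ μ) → IsPointStationaryLaw P →
      (∫ μ, rootEnergy lennardJones μ ∂P) ≤
        (⨅ Q : PeriodicConfiguration 3, Q.energyPerParticle lennardJones) →
      ∀ᵐ μ ∂P, ∃ Y : Set (EuclideanSpace ℝ (Fin 3)), 0 < P (Cls Y) ∧ μ ∈ Cls Y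

/-- **(C) Orbit finiteness of atoms** (non-coplanar case): GIVEN (A), (G), (F), a rooted-isometry
class charged by a point-stationary a.s.-hard-core probability law, one of whose hard-core copies is
not a slab, has finitely many symmetry orbits (Mecke mass formula `m(b)·|Stab_b| = const > 0` +
bounded stabilisers, or directly a rank-3 period lattice). -/
def FiniteOrbitsOfCharged : Prop :=
  MeasurableClass → SymDiscontinuous → GroupStructure →
  ∀ δ : ℝ, 0 < δ → ∀ P : Measure (Measure (EuclideanSpace ℝ (Fin 3))), IsProbabilityMeasure P →
    (∀ᵐ μ ∂P, IsRootedHardCore δ μ) → IsPointStationaryLaw P →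
    ∀ Y : Set (EuclideanSpace ℝ (Fin 3)), 0 < P (Cls Y) →
      ∀ μ ∈ Cls Y, IsRootedHardCore δ μ → ¬ Slab μ →
      Literature.Geometry.DiscreteGeometry.HasFinitelyManySymmetryOrbits Y

/-- **(D) Slab-or-dense dichotomy**: GIVEN (G), (F), a rooted hard-core copy of a set with finitely
many symmetry orbits is relatively dense or a slab. -/
def SlabOrDense : Prop :=
  SymDiscontinuous → GroupStructure →
  ∀ δ : ℝ, 0 < δ → ∀ Y : Set (EuclideanSpace ℝ (Fin 3)),
    Literature.Geometry.DiscreteGeometry.HasFinitelyManySymmetryOrbits Y →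
    ∀ μ ∈ Cls Y, IsRootedHardCore δ μ → RelDense μ ∨ Slab μ

/-- **(E) No minimising slabs**: GIVEN the floor, a minimising law a.s. charges no slab
configuration (films, rods, layers, clusters: stack translates into the free direction). -/
def NoSlabs : Prop :=
  EnergyFloor →
    ∀ δ : ℝ, 0 < δ → ∀ P : Measure (Measure (EuclideanSpace ℝ (Fin 3))), IsProbabilityMeasure P →
      (∀ᵐ μ ∂P, IsRootedHardCore δ μ) → IsPointStationaryLaw P →
      (∫ μ, rootEnergy lennardJones μ ∂P) ≤
        (⨅ Q : PeriodicConfiguration 3, Q.energyPerParticle lennardJones) →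
      ∀ᵐ μ ∂P, ¬ Slab μ

/-! ## §1b The floor (S1) is a tree theorem -/

/-- **(S1) holds**: the energy floor is item 9229 `UnimodularEnergyLowerBound`, proved in the tree by
the random-grid mass transport (`PalmUnimodularRigidityMinimiserShells.EnergyFloor.stub_energyFloor`);
`rootEnergy V μ = (∫ V ‖y‖ dμ)/2` and `IsRootedHardCore` / `IsPointStationaryLaw` unfold to its
inlined hypotheses, so the terms agree definitionally. -/
theorem energyFloor : EnergyFloor :=
  Summit.AtomisticToContinuum.Crystallization.Theorems.PalmUnimodularRigidityMinimiserShells.EnergyFloor.stub_energyFloor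

/-! ## §2 The registered stubs — ALL LANDED (2026-08-17); discharged here by `exact` of the tree theorems

Each `stub_*` restates its statement of §1 VERBATIM over tree declarations (fully qualified, the
local vocabulary expanded), so that the signature recorded by `ledger skeleton check` elaborates in
the route context. -/

/-- **STUB (A)** — measurable single-root congruence classes of a separated set (L; finite nets of
`O(3)`, separation ⇒ exact match from approximate matches at all scales; no kernels needed). -/
theorem stub_measurableClass :
    ∀ δ : ℝ, 0 < δ → ∀ Y : Set (EuclideanSpace ℝ (Fin 3)),
      (∀ x ∈ Y, ∀ y ∈ Y, x ≠ y → δ ≤ dist x y) → ∀ q : EuclideanSpace ℝ (Fin 3),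
      MeasurableSet {μ : MeasureTheory.Measure (EuclideanSpace ℝ (Fin 3)) |
        ∃ A : EuclideanSpace ℝ (Fin 3) →ₗᵢ[ℝ] EuclideanSpace ℝ (Fin 3),
          μ = (MeasureTheory.Measure.count : MeasureTheory.Measure (EuclideanSpace ℝ (Fin 3))).restrict
            ((fun s => A (s - q)) '' Y)} := by
  intro δ hδ Y hY q
  exact Summit.AtomisticToContinuum.Crystallization.Theorems.IsometryAtomsMinimisingLawsCohesive.MeasurableClassB.measurableClass_b q Y δ hδ hY

example : MeasurableClass := stub_measurableClass

/-- **STUB (G)** — the symmetry group of a separated non-coplanar set is discontinuous (M; an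
isometry is fixed by four affinely independent points; their images lie in a finite patch). -/
theorem stub_symDiscontinuous :
    ∀ δ : ℝ, 0 < δ → ∀ Y : Set (EuclideanSpace ℝ (Fin 3)),
      (∀ x ∈ Y, ∀ y ∈ Y, x ≠ y → δ ≤ dist x y) →
      (¬ ∃ n : EuclideanSpace ℝ (Fin 3), n ≠ 0 ∧ ∃ c : ℝ, ∀ y ∈ Y, inner ℝ y n = c) →
      ∀ R : ℝ, {g : EuclideanSpace ℝ (Fin 3) ≃ᵃⁱ[ℝ] EuclideanSpace ℝ (Fin 3) |
        g '' Y = Y ∧ ∃ x : EuclideanSpace ℝ (Fin 3), ‖x‖ ≤ R ∧ ‖g x‖ ≤ R}.Finite := by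
  intro δ hδ Y hY hnc R
  exact Summit.AtomisticToContinuum.Crystallization.Theorems.IsometryAtomsMinimisingLawsCohesive.SymDiscontinuousB.symDiscontinuous_b Y R δ hδ hY hnc

example : SymDiscontinuous := stub_symDiscontinuous

/-- **STUB (F)** — structure of discontinuous groups of isometries of `ℝ³` (XL, held by the lead;
elementary Bieberbach in dimension three by translation rank, lattice isometry groups finite, fixed
points of translation-free plane groups, and the `SO(3)` commutator contraction in rank `0`). -/
theorem stub_groupStructure :
    ∀ Γ : Subgroup (EuclideanSpace ℝ (Fin 3) ≃ᵢ EuclideanSpace ℝ (Fin 3)),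
      Literature.Geometry.DiscreteGeometry.Crystallographic.IsDiscontinuous Γ →
      (∃ N : ℕ, ∀ H : Subgroup (EuclideanSpace ℝ (Fin 3) ≃ᵢ EuclideanSpace ℝ (Fin 3)),
          H ≤ Γ → Finite H → Nat.card H ≤ N) ∧
      ((∃ v : Fin 3 → EuclideanSpace ℝ (Fin 3),
          LinearIndependent ℝ v ∧ ∀ i, IsometryEquiv.addRight (v i) ∈ Γ) ∨
       (∃ V : AffineSubspace ℝ (EuclideanSpace ℝ (Fin 3)),
          (V : Set (EuclideanSpace ℝ (Fin 3))).Nonempty ∧ Module.finrank ℝ V.direction ≤ 2 ∧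
          ∀ g ∈ Γ, g '' (V : Set (EuclideanSpace ℝ (Fin 3))) = V)) := by
  exact Summit.AtomisticToContinuum.Crystallization.Theorems.IsometryAtomsMinimisingLawsCohesive.stub_groupStructure

example : GroupStructure := stub_groupStructure

/-- **STUB (B)** — pure exhaustion (M/L; classes equal-or-disjoint, countably many charged,
conditioning on the (a.e.-)invariant complement keeps the frame and — by the floor — minimality
(`MinimiserShells.Negative.Rootedness.meanRootEnergy_cond_le_of_minimising`), then X₁). -/
theorem stub_pureExhaustion :
    Summit.AtomisticToContinuum.Crystallization.Theses.IsometryAtoms.MinimisingLawsHaveAtoms →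
    (∀ δ : ℝ, 0 < δ →
      ∀ P : MeasureTheory.Measure (MeasureTheory.Measure (EuclideanSpace ℝ (Fin 3))),
        MeasureTheory.IsProbabilityMeasure P →
        (∀ᵐ μ ∂P, Literature.Probability.Process.IsRootedHardCore δ μ) →
        Literature.Probability.Process.IsPointStationaryLaw P →
        (⨅ Q : Literature.MathematicalPhysics.StatisticalMechanics.PeriodicConfiguration 3,
            Q.energyPerParticle Literature.MathematicalPhysics.StatisticalMechanics.lennardJones) ≤
          ∫ μ, Literature.MathematicalPhysics.StatisticalMechanics.rootEnergy
            Literature.MathematicalPhysics.StatisticalMechanics.lennardJones μ ∂P) →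
    (∀ δ : ℝ, 0 < δ → ∀ Y : Set (EuclideanSpace ℝ (Fin 3)),
      (∀ x ∈ Y, ∀ y ∈ Y, x ≠ y → δ ≤ dist x y) → ∀ q : EuclideanSpace ℝ (Fin 3),
      MeasurableSet {μ : MeasureTheory.Measure (EuclideanSpace ℝ (Fin 3)) |
        ∃ A : EuclideanSpace ℝ (Fin 3) →ₗᵢ[ℝ] EuclideanSpace ℝ (Fin 3),
          μ = (MeasureTheory.Measure.count : MeasureTheory.Measure (EuclideanSpace ℝ (Fin 3))).restrict
            ((fun s => A (s - q)) '' Y)}) →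
    ∀ δ : ℝ, 0 < δ →
      ∀ P : MeasureTheory.Measure (MeasureTheory.Measure (EuclideanSpace ℝ (Fin 3))),
        MeasureTheory.IsProbabilityMeasure P →
        (∀ᵐ μ ∂P, Literature.Probability.Process.IsRootedHardCore δ μ) →
        Literature.Probability.Process.IsPointStationaryLaw P →
        (∫ μ, Literature.MathematicalPhysics.StatisticalMechanics.rootEnergy
            Literature.MathematicalPhysics.StatisticalMechanics.lennardJones μ ∂P) ≤
          (⨅ Q : Literature.MathematicalPhysics.StatisticalMechanics.PeriodicConfiguration 3,
            Q.energyPerParticle Literature.MathematicalPhysics.StatisticalMechanics.lennardJones) →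
        ∀ᵐ μ ∂P, ∃ Y : Set (EuclideanSpace ℝ (Fin 3)),
          0 < P {ν : MeasureTheory.Measure (EuclideanSpace ℝ (Fin 3)) |
                ∃ A : EuclideanSpace ℝ (Fin 3) →ₗᵢ[ℝ] EuclideanSpace ℝ (Fin 3), ∃ q ∈ Y,
                  ν = (MeasureTheory.Measure.count : MeasureTheory.Measure (EuclideanSpace ℝ (Fin 3))).restrict
                    ((fun s => A (s - q)) '' Y)} ∧
          ∃ A : EuclideanSpace ℝ (Fin 3) →ₗᵢ[ℝ] EuclideanSpace ℝ (Fin 3), ∃ q ∈ Y,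
            μ = (MeasureTheory.Measure.count : MeasureTheory.Measure (EuclideanSpace ℝ (Fin 3))).restrict
              ((fun s => A (s - q)) '' Y) := by
  exact Summit.AtomisticToContinuum.Crystallization.Theorems.IsometryAtomsMinimisingLawsCohesive.stub_pureExhaustion

example : PureExhaustion := stub_pureExhaustion

/-- **STUB (C)** — orbit finiteness of charged non-coplanar classes (L; Mecke with
`g = 1_{K_a}(μ) 1_{K_b}(θ_y μ) 1{‖y‖ ≤ r}` gives `m(a)·n_ab(r) = m(b)·n_ba(r)`, the symmetry count
`#{γ : ‖γ b − a‖ ≤ r} = n_ab(r)|Stab_b| = n_ba(r)|Stab_a|` gives `m(b)|Stab_b| = const > 0`, and (F)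
bounds `|Stab_b|` — or gives a rank-3 period lattice, hence finitely many orbits outright). -/
theorem stub_finiteOrbitsOfCharged :
    (∀ δ : ℝ, 0 < δ → ∀ Y : Set (EuclideanSpace ℝ (Fin 3)),
      (∀ x ∈ Y, ∀ y ∈ Y, x ≠ y → δ ≤ dist x y) → ∀ q : EuclideanSpace ℝ (Fin 3),
      MeasurableSet {μ : MeasureTheory.Measure (EuclideanSpace ℝ (Fin 3)) |
        ∃ A : EuclideanSpace ℝ (Fin 3) →ₗᵢ[ℝ] EuclideanSpace ℝ (Fin 3),
          μ = (MeasureTheory.Measure.count : MeasureTheory.Measure (EuclideanSpace ℝ (Fin 3))).restrict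
            ((fun s => A (s - q)) '' Y)}) →
    (∀ δ : ℝ, 0 < δ → ∀ Y : Set (EuclideanSpace ℝ (Fin 3)),
      (∀ x ∈ Y, ∀ y ∈ Y, x ≠ y → δ ≤ dist x y) →
      (¬ ∃ n : EuclideanSpace ℝ (Fin 3), n ≠ 0 ∧ ∃ c : ℝ, ∀ y ∈ Y, inner ℝ y n = c) →
      ∀ R : ℝ, {g : EuclideanSpace ℝ (Fin 3) ≃ᵃⁱ[ℝ] EuclideanSpace ℝ (Fin 3) |
        g '' Y = Y ∧ ∃ x : EuclideanSpace ℝ (Fin 3), ‖x‖ ≤ R ∧ ‖g x‖ ≤ R}.Finite) →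
    (∀ Γ : Subgroup (EuclideanSpace ℝ (Fin 3) ≃ᵢ EuclideanSpace ℝ (Fin 3)),
      Literature.Geometry.DiscreteGeometry.Crystallographic.IsDiscontinuous Γ →
      (∃ N : ℕ, ∀ H : Subgroup (EuclideanSpace ℝ (Fin 3) ≃ᵢ EuclideanSpace ℝ (Fin 3)),
          H ≤ Γ → Finite H → Nat.card H ≤ N) ∧
      ((∃ v : Fin 3 → EuclideanSpace ℝ (Fin 3),
          LinearIndependent ℝ v ∧ ∀ i, IsometryEquiv.addRight (v i) ∈ Γ) ∨
       (∃ V : AffineSubspace ℝ (EuclideanSpace ℝ (Fin 3)),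
          (V : Set (EuclideanSpace ℝ (Fin 3))).Nonempty ∧ Module.finrank ℝ V.direction ≤ 2 ∧
          ∀ g ∈ Γ, g '' (V : Set (EuclideanSpace ℝ (Fin 3))) = V))) →
    ∀ δ : ℝ, 0 < δ →
      ∀ P : MeasureTheory.Measure (MeasureTheory.Measure (EuclideanSpace ℝ (Fin 3))),
        MeasureTheory.IsProbabilityMeasure P →
        (∀ᵐ μ ∂P, Literature.Probability.Process.IsRootedHardCore δ μ) →
        Literature.Probability.Process.IsPointStationaryLaw P →
        ∀ Y : Set (EuclideanSpace ℝ (Fin 3)),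
          0 < P {ν : MeasureTheory.Measure (EuclideanSpace ℝ (Fin 3)) |
                ∃ A : EuclideanSpace ℝ (Fin 3) →ₗᵢ[ℝ] EuclideanSpace ℝ (Fin 3), ∃ q ∈ Y,
                  ν = (MeasureTheory.Measure.count : MeasureTheory.Measure (EuclideanSpace ℝ (Fin 3))).restrict
                    ((fun s => A (s - q)) '' Y)} →
          ∀ μ : MeasureTheory.Measure (EuclideanSpace ℝ (Fin 3)),
            (∃ A : EuclideanSpace ℝ (Fin 3) →ₗᵢ[ℝ] EuclideanSpace ℝ (Fin 3), ∃ q ∈ Y,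
              μ = (MeasureTheory.Measure.count : MeasureTheory.Measure (EuclideanSpace ℝ (Fin 3))).restrict
                ((fun s => A (s - q)) '' Y)) →
            Literature.Probability.Process.IsRootedHardCore δ μ →
            (¬ ∃ A : EuclideanSpace ℝ (Fin 3) →ₗᵢ[ℝ] EuclideanSpace ℝ (Fin 3), ∃ D : ℝ,
                ∀ y : EuclideanSpace ℝ (Fin 3), μ {y} ≠ 0 → |A y 0| ≤ D) →
            (∃ S : Finset (EuclideanSpace ℝ (Fin 3)), ∀ x ∈ Y,
              ∃ g : EuclideanSpace ℝ (Fin 3) ≃ᵃⁱ[ℝ] EuclideanSpace ℝ (Fin 3),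
                g '' Y = Y ∧ g x ∈ (S : Set (EuclideanSpace ℝ (Fin 3)))) := by
  exact Summit.AtomisticToContinuum.Crystallization.Theorems.IsometryAtomsMinimisingLawsCohesive.stub_finiteOrbitsOfCharged

example : FiniteOrbitsOfCharged := stub_finiteOrbitsOfCharged

/-- **STUB (D)** — slab-or-dense dichotomy (L; coplanar ⇒ slab; otherwise `Sym(Y)` is discontinuous
by (G) and (F) applies: three independent translations ⇒ `Y ⊇ y + L` relatively dense; an invariant
point / line / plane `V` ⇒ every orbit keeps its distance to `V`, finitely many orbits ⇒ `Y` within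
bounded distance of a plane ⇒ slab; transport along the isometry `A(· − q)`). -/
theorem stub_slabOrDense :
    (∀ δ : ℝ, 0 < δ → ∀ Y : Set (EuclideanSpace ℝ (Fin 3)),
      (∀ x ∈ Y, ∀ y ∈ Y, x ≠ y → δ ≤ dist x y) →
      (¬ ∃ n : EuclideanSpace ℝ (Fin 3), n ≠ 0 ∧ ∃ c : ℝ, ∀ y ∈ Y, inner ℝ y n = c) →
      ∀ R : ℝ, {g : EuclideanSpace ℝ (Fin 3) ≃ᵃⁱ[ℝ] EuclideanSpace ℝ (Fin 3) |
        g '' Y = Y ∧ ∃ x : EuclideanSpace ℝ (Fin 3), ‖x‖ ≤ R ∧ ‖g x‖ ≤ R}.Finite) →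
    (∀ Γ : Subgroup (EuclideanSpace ℝ (Fin 3) ≃ᵢ EuclideanSpace ℝ (Fin 3)),
      Literature.Geometry.DiscreteGeometry.Crystallographic.IsDiscontinuous Γ →
      (∃ N : ℕ, ∀ H : Subgroup (EuclideanSpace ℝ (Fin 3) ≃ᵢ EuclideanSpace ℝ (Fin 3)),
          H ≤ Γ → Finite H → Nat.card H ≤ N) ∧
      ((∃ v : Fin 3 → EuclideanSpace ℝ (Fin 3),
          LinearIndependent ℝ v ∧ ∀ i, IsometryEquiv.addRight (v i) ∈ Γ) ∨
       (∃ V : AffineSubspace ℝ (EuclideanSpace ℝ (Fin 3)),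
          (V : Set (EuclideanSpace ℝ (Fin 3))).Nonempty ∧ Module.finrank ℝ V.direction ≤ 2 ∧
          ∀ g ∈ Γ, g '' (V : Set (EuclideanSpace ℝ (Fin 3))) = V))) →
    ∀ δ : ℝ, 0 < δ → ∀ Y : Set (EuclideanSpace ℝ (Fin 3)),
      (∃ S : Finset (EuclideanSpace ℝ (Fin 3)), ∀ x ∈ Y,
            ∃ g : EuclideanSpace ℝ (Fin 3) ≃ᵃⁱ[ℝ] EuclideanSpace ℝ (Fin 3),
              g '' Y = Y ∧ g x ∈ (S : Set (EuclideanSpace ℝ (Fin 3)))) →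
      ∀ μ : MeasureTheory.Measure (EuclideanSpace ℝ (Fin 3)),
        (∃ A : EuclideanSpace ℝ (Fin 3) →ₗᵢ[ℝ] EuclideanSpace ℝ (Fin 3), ∃ q ∈ Y,
          μ = (MeasureTheory.Measure.count : MeasureTheory.Measure (EuclideanSpace ℝ (Fin 3))).restrict
            ((fun s => A (s - q)) '' Y)) →
        Literature.Probability.Process.IsRootedHardCore δ μ →
        (∃ R₀ : ℝ, ∀ z : EuclideanSpace ℝ (Fin 3), ∃ y : EuclideanSpace ℝ (Fin 3),
            μ {y} ≠ 0 ∧ dist z y ≤ R₀) ∨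
        (∃ A : EuclideanSpace ℝ (Fin 3) →ₗᵢ[ℝ] EuclideanSpace ℝ (Fin 3), ∃ D : ℝ,
            ∀ y : EuclideanSpace ℝ (Fin 3), μ {y} ≠ 0 → |A y 0| ≤ D) := by
  exact Summit.AtomisticToContinuum.Crystallization.Theorems.IsometryAtomsMinimisingLawsCohesive.stub_slabOrDense

example : SlabOrDense := stub_slabOrDense

/-- **STUB (E)** — no minimising slabs (L; every hard-core slab configuration lies in one of the
countably many measurable, re-rooting-invariant events `G_{j,t}` = "all cross differences avoid
`ℤ⋆ t e_j + B(0,1)`" (`j ∈ Fin 3`, `t ∈ ℕ`): for a slab of width `w` and normal `n₀` some coordinate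
axis has `|⟨e_j, n₀⟩| ≥ 1/√3`, take `t ≥ √3 (w + 2)`; if `P(G_{j,t}) > 0`, condition on it (floor ⇒ still
minimising, `meanRootEnergy_cond_le_of_minimising`), stack `μ ↦ Σ_{k ∈ ℤ} μ(· − k t e_j)` with CONSTANT
`j, t`: the image law is point-stationary (Mecke of the conditioned law with `G(μ,y) = Σ_k g(Stack μ,
y + k t e_j)`), `min(δ,1)`-hard-core, a probability, and every cross term is `V_LJ(r) < 0` (`r ≥ 1`),
the two root copies `± t e_j` contributing `V_LJ(t) < 0`: mean root energy strictly below `e*`,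
contradicting the floor). -/
theorem stub_noSlabs :
    (∀ δ : ℝ, 0 < δ →
      ∀ P : MeasureTheory.Measure (MeasureTheory.Measure (EuclideanSpace ℝ (Fin 3))),
        MeasureTheory.IsProbabilityMeasure P →
        (∀ᵐ μ ∂P, Literature.Probability.Process.IsRootedHardCore δ μ) →
        Literature.Probability.Process.IsPointStationaryLaw P →
        (⨅ Q : Literature.MathematicalPhysics.StatisticalMechanics.PeriodicConfiguration 3,
            Q.energyPerParticle Literature.MathematicalPhysics.StatisticalMechanics.lennardJones) ≤
          ∫ μ, Literature.MathematicalPhysics.StatisticalMechanics.rootEnergy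
            Literature.MathematicalPhysics.StatisticalMechanics.lennardJones μ ∂P) →
    ∀ δ : ℝ, 0 < δ →
      ∀ P : MeasureTheory.Measure (MeasureTheory.Measure (EuclideanSpace ℝ (Fin 3))),
        MeasureTheory.IsProbabilityMeasure P →
        (∀ᵐ μ ∂P, Literature.Probability.Process.IsRootedHardCore δ μ) →
        Literature.Probability.Process.IsPointStationaryLaw P →
        (∫ μ, Literature.MathematicalPhysics.StatisticalMechanics.rootEnergy
            Literature.MathematicalPhysics.StatisticalMechanics.lennardJones μ ∂P) ≤
          (⨅ Q : Literature.MathematicalPhysics.StatisticalMechanics.PeriodicConfiguration 3,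
            Q.energyPerParticle Literature.MathematicalPhysics.StatisticalMechanics.lennardJones) →
        ∀ᵐ μ ∂P, ¬ ∃ A : EuclideanSpace ℝ (Fin 3) →ₗᵢ[ℝ] EuclideanSpace ℝ (Fin 3), ∃ D : ℝ,
            ∀ y : EuclideanSpace ℝ (Fin 3), μ {y} ≠ 0 → |A y 0| ≤ D := by
  exact Summit.AtomisticToContinuum.Crystallization.Theorems.IsometryAtomsMinimisingLawsCohesive.stub_noSlabs

example : NoSlabs := stub_noSlabs

/-! ## §3 Name-keyed aliases (hypotheses of the composition)

`Registered.stub_X` is the statement of `stub_X` under the registered stub's short name, so that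
the skeleton audit (`#h21_check_skeleton`: hypotheses admissible iff registered stubs / route items
BY NAME) accepts `MinimisingLawsCohesive_of`. -/
namespace Registered

/-- Alias of `MeasurableClass` keyed by the registered stub name. -/
abbrev stub_measurableClass : Prop := MeasurableClass
/-- Alias of `SymDiscontinuous` keyed by the registered stub name. -/
abbrev stub_symDiscontinuous : Prop := SymDiscontinuous
/-- Alias of `GroupStructure` keyed by the registered stub name. -/
abbrev stub_groupStructure : Prop := GroupStructure
/-- Alias of `PureExhaustion` keyed by the registered stub name. -/
abbrev stub_pureExhaustion : Prop := PureExhaustion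
/-- Alias of `FiniteOrbitsOfCharged` keyed by the registered stub name. -/
abbrev stub_finiteOrbitsOfCharged : Prop := FiniteOrbitsOfCharged
/-- Alias of `SlabOrDense` keyed by the registered stub name. -/
abbrev stub_slabOrDense : Prop := SlabOrDense
/-- Alias of `NoSlabs` keyed by the registered stub name. -/
abbrev stub_noSlabs : Prop := NoSlabs

end Registered

/-! ## §4 The composition (kernel-checked, no sorry) -/

/-- **`MinimisingLawsCohesive_of`** — PURITY (the route item `MinimisingLawsHaveAtoms`, by name) and
the seven registered stubs give the crux BY NAME: the floor is the tree theorem `energyFloor`; a.e.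
`μ` lies in a charged class `Cls Y` (exhaustion B, fed with X₁, the floor and A) and is hard-core;
a.e. `μ` is not a slab (stacking E, fed with the floor); so `Y` is not coplanar and has finitely many
symmetry orbits (C, fed with A, G, F); hence `μ` is relatively dense or a slab (D, fed with G, F), and
the slab branch is absurd. (The only theorem of this file whose conclusion is the crux.) -/
theorem MinimisingLawsCohesive_of (hX₁ : MinimisingLawsHaveAtoms)
    (hA : Registered.stub_measurableClass) (hG : Registered.stub_symDiscontinuous)
    (hF : Registered.stub_groupStructure) (hB : Registered.stub_pureExhaustion)
    (hC : Registered.stub_finiteOrbitsOfCharged) (hD : Registered.stub_slabOrDense)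
    (hE : Registered.stub_noSlabs) :
    MinimisingLawsCohesive := by
  intro δ hδ P hP hhc hst hEn
  -- a.e. configuration lies in a CHARGED rooted-isometry class (purity + floor + measurability) …
  have hex := hB hX₁ energyFloor hA δ hδ P hP hhc hst hEn
  -- … and a.e. configuration is not a slab (floor + stacking)
  have hns := hE energyFloor δ hδ P hP hhc hst hEn
  filter_upwards [hex, hns, hhc] with μ hμ hnμ hhcμ
  obtain ⟨Y, hY, hμY⟩ := hμ
  -- the charged class has finitely many symmetry orbits (its copy `μ` is no slab), hence dense or slab
  rcases hD hG hF δ hδ Y (hC hA hG hF δ hδ P hP hhc hst Y hY μ hμY hhcμ hnμ) μ hμY hhcμ with h | h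
  · exact h
  · exact absurd h hnμ

/-- Wiring check: the registered stubs feed `MinimisingLawsCohesive_of` as stated. -/
example (hX₁ : MinimisingLawsHaveAtoms) : MinimisingLawsCohesive :=
  MinimisingLawsCohesive_of hX₁ stub_measurableClass stub_symDiscontinuous stub_groupStructure
    stub_pureExhaustion stub_finiteOrbitsOfCharged stub_slabOrDense stub_noSlabs

/-! ## §5 Calibration (sorry-free) -/

open Summit.AtomisticToContinuum.Crystallization.Theorems.ChargedEnergyGapNegative (eStar)
open Summit.AtomisticToContinuum.Crystallization.Theorems.MinimisingLawsCohesive.Negative.OnePointMixtures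
  (eStar_le_integral_of_minimisingLawsCohesive minimisingLawsCohesive_iff_stable_and_exact)

/-- **The floor is not a detour**: the crux itself implies `EnergyFloor` (landed Negative lemma
`eStar_le_integral_of_minimisingLawsCohesive`: otherwise a mixture with the one-point law is
minimising and charges `δ_0`). So (S1) is a NECESSARY conjunct of any proof. -/
theorem crux_implies_energyFloor (H : MinimisingLawsCohesive) : EnergyFloor := by
  intro δ hδ P hP hhc hst
  haveI := hP
  exact eStar_le_integral_of_minimisingLawsCohesive H hδ P hhc hst

/-- (S1) is literally the stability conjunct of the landed splitting
`minimisingLawsCohesive_iff_stable_and_exact` (the `⨅` is `eStar` by `rfl`). -/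
example : EnergyFloor ↔
    (∀ δ : ℝ, 0 < δ → ∀ P : Measure (Measure (EuclideanSpace ℝ (Fin 3))),
      IsProbabilityMeasure P → (∀ᵐ μ ∂P, IsRootedHardCore δ μ) → IsPointStationaryLaw P →
      eStar ≤ ∫ μ, rootEnergy lennardJones μ ∂P) :=
  Iff.rfl

/-- A coordinate of a vector of `ℝ³` is bounded by its norm. -/
theorem abs_apply_le_norm (x : EuclideanSpace ℝ (Fin 3)) (i : Fin 3) : |x i| ≤ ‖x‖ := by
  simpa [Real.norm_eq_abs] using PiLp.norm_apply_le x i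

/-- **A slab configuration is never relatively dense** (for ANY measure `μ`): far along the normal
direction there is a point of space with no point of `μ` within `R₀`. Hence the conclusion of (S4)
is a genuine special case of the crux (films / rods / layers / clusters), and (S3b) ∧ (S4) is how
the crux is reached on atoms. -/
theorem not_relDense_of_slab {μ : Measure (EuclideanSpace ℝ (Fin 3))} (h : Slab μ) :
    ¬ RelDense μ := by
  rintro ⟨R₀, hR⟩
  obtain ⟨A, D, hD⟩ := h
  -- the linear isometry is onto (finite dimension): pick `z` with first `A`-coordinate `|D| + |R₀| + 1`
  let e : EuclideanSpace ℝ (Fin 3) ≃ₗᵢ[ℝ] EuclideanSpace ℝ (Fin 3) := A.toLinearIsometryEquiv rfl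
  let w : EuclideanSpace ℝ (Fin 3) := EuclideanSpace.single (0 : Fin 3) (|D| + |R₀| + 1)
  obtain ⟨y, hy, hzy⟩ := hR (e.symm w)
  have hAy : |A y 0| ≤ D := hD y hy
  have hAz : A (e.symm w) = w := by
    change e (e.symm w) = w
    exact e.apply_symm_apply w
  have hw0 : w 0 = |D| + |R₀| + 1 := by simp [w]
  -- `|w 0 - A y 0| ≤ ‖w - A y‖ = ‖A (e.symm w) - A y‖ = dist (e.symm w) y ≤ R₀`
  have hdist : |w 0 - A y 0| ≤ R₀ := by
    have h1 : |(w - A y) 0| ≤ ‖w - A y‖ := abs_apply_le_norm (w - A y) 0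
    have h2 : ‖w - A y‖ = dist (e.symm w) y := by
      conv_lhs => rw [← hAz]
      rw [← map_sub, A.norm_map, dist_eq_norm]
    have h3 : (w - A y) 0 = w 0 - A y 0 := by simp
    rw [h3, h2] at h1
    exact h1.trans hzy
  rw [hw0] at hdist
  have := abs_sub_abs_le_abs_sub (|D| + |R₀| + 1) (A y 0)
  have h4 : |(|D| + |R₀| + 1)| = |D| + |R₀| + 1 := abs_of_pos (by positivity)
  rw [h4] at this
  have h5 : |A y 0| ≤ |D| := hAy.trans (le_abs_self D)
  have h6 : R₀ ≤ |R₀| := le_abs_self R₀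
  linarith

/-- Consequently the crux implies the conclusion of (S4) outright (no floor needed): minimising laws
a.s. charge no slab. -/
theorem crux_implies_noSlabs_conclusion (H : MinimisingLawsCohesive) :
    ∀ δ : ℝ, 0 < δ → ∀ P : Measure (Measure (EuclideanSpace ℝ (Fin 3))), IsProbabilityMeasure P →
      (∀ᵐ μ ∂P, IsRootedHardCore δ μ) → IsPointStationaryLaw P →
      (∫ μ, rootEnergy lennardJones μ ∂P) ≤
        (⨅ Q : PeriodicConfiguration 3, Q.energyPerParticle lennardJones) →
      ∀ᵐ μ ∂P, ¬ Slab μ := by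
  intro δ hδ P hP hhc hst hE
  filter_upwards [H δ hδ P hP hhc hst hE] with μ hμ hs
  exact not_relDense_of_slab hs hμ

/-- The one-point configuration `δ_0` (the admissible atom of
`AtomicLawChargesCrystal/Negative/FalseWithoutRelDense`) is a slab configuration — the degenerate
witness that (S4) needs the energy (it has mean root energy `0 > e*`, so the floor excludes it). -/
example : Slab (Measure.dirac (0 : EuclideanSpace ℝ (Fin 3))) := by
  refine ⟨LinearIsometry.id, 0, fun y hy => ?_⟩
  have hy0 : y = 0 := by
    by_contra hne
    apply hy
    rw [Measure.dirac_apply' _ (measurableSet_singleton y)]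
    simp [Set.indicator_of_notMem, Ne.symm hne]
  subst hy0
  simp

/-- Every configuration is in the rooted isometry class of its own point set (`A = id`, `q = 0`):
the content of (S2) is the POSITIVE MASS of the class, not membership. -/
example (S : Set (EuclideanSpace ℝ (Fin 3))) (h0 : (0 : EuclideanSpace ℝ (Fin 3)) ∈ S) :
    (Measure.count : Measure (EuclideanSpace ℝ (Fin 3))).restrict S ∈ Cls S := by
  refine ⟨LinearIsometry.id, 0, h0, ?_⟩
  congr 1
  ext z
  simp

end Summit.AtomisticToContinuum.Crystallization.Cruxes.MinimisingLawsCohesive.PurityStacking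

end
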